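import Mathlib
import HarnessLib
import Summits.AtomisticToContinuum.FouriersLaw.Theses.JunctionLocality
import Summits.AtomisticToContinuum.FouriersLaw.Theorems.JunctionLocalitySuperadditiveResistanceStubBypassBoundAux5
import Summits.AtomisticToContinuum.FouriersLaw.Theorems.JunctionLocalitySuperadditiveResistanceStubTerminationLocalityAux6
import Summits.AtomisticToContinuum.FouriersLaw.Theorems.JunctionLocalitySuperadditiveResistanceDeviceBlockCoordinates

/-!
# Bypass-bound helpers VII: the DOUBLE-DEFECT ("double escape") form of the bypass
(helpers `--supports` stmt-AtomisticToContinuum-11748 for stub `stub_bypassBound` (S2') of line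
`floating-probe-bypass-laplacian`, skeleton v7, crux `JunctionLocality.SuperadditiveResistance`)

Notation as in parts IV–VI (`…StubBypassBoundAux4/5/6`): `g` a family of `κ`-resolvent fields of the four terminals of
the `(N, M)`-device, `x = −K₀₃`, `a = K₀₀`, `b = K₃₃`, `L = N + M`, `R` the momentum reversal, `π_N` the left-block map
(`restrictLeft`), `Φ = blockSwap N M`, `V'(r) = r + βr³` (`junctionForce`), `r_J = q_N − q_{N−1}`; `g_N` (`g_M`) a plain
forward field of the bare `N`- (`M`-) chain, `G_N = plainKubo … g_N`. Part V isolated S2' LOSSLESSLY as the far-pairing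
bound on `X := ⟨g_3∘R, s_N⟩_{μ_T}`, `s_N := V'(r_J)(∂_{p_{N−1}} g_N)∘π_N − κ g_N∘π_N` (the source of the NEAR defect
`u_0 := g_0 − g_N∘π_N`: `κ u_0 − L_dev u_0 = s_N`), `x = (γ²/T²) X`. This file (fixed `N, M, κ`; exact; no named fact, no
new definition — the far-block players are lambdas) pairs the near defect against the FAR defect:

* the FAR PLAIN LIFT `G_M := g_M∘π_M∘Φ` (`fun y => g_M (restrictLeft M N (blockSwap N M y))`: the bare `M`-chain's plain
  field read on the right block, source bath = the device's far bath `L−1`, γ-bathed end = the junction site `N`) and its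
  FAR JUNCTION SOURCE `J_M := (V'·(∂_{p_{M−1}} g_M)∘π_M)∘Φ = −V'(r_J)·∂_{p_N} G_M` (`farJunctionSource_eq`; regularity
  `contDiff_/memLp_farPlainLift`, `memLp_/continuous_farJunctionSource`);
* `farDefect_resolvent`, `farDefect_pair_far` — the FAR DEFECT `v_3 := g_3 − G_M` solves `κ v_3 − L_dev v_3 = s_M`,
  `s_M := J_M − κ G_M` (block swap of helper V's `deviceResolvent_defect`: `g_3` is the near resolvent field of the
  swapped `(M, N)`-device, `comp_blockSwap_mem_deviceResolventFields`);
* **`defect_reciprocity`** — `⟨v_3∘R, s_N⟩_{μ_T} = ⟨u_0, s_M∘R⟩_{μ_T}` (the landed cross Green identity `Kubo.cross` for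
  the forward pair `(u_0, s_N − κu_0)` against the backward pair `(v_3∘R, s_M∘R − κ v_3∘R)`; the `κ⟨u_0, v_3∘R⟩` cancel);
* **`bypass_eq_doubleDefect`** and its written-out registered form `helper_bypassDoubleDefectIdentity` — THE
  DOUBLE-DEFECT IDENTITY `−K₀₃ = (γ²/T²)·( ⟨u_0, s_M∘R⟩_{μ_T} + ⟨G_M∘R, s_N⟩_{μ_T} )`, i.e. `X = D + S` with the DYNAMIC
  term `D = ⟨u_0, V'(r_J)∂_{p_N}(G_M∘R) − κ G_M∘R⟩` (near DEFECT × far junction source; `= ⟨v_3∘R, s_N⟩`) and the STATIC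
  term `S = ⟨G_M∘R, s_N⟩` (an equilibrium junction correlation of the two BARE plain fields — no device field).

WHERE CAUCHY–SCHWARZ WITH THE FREE `N`-UNIFORM BUDGETS STOPS (report; not formalised). Budgets:
`helper_terminationEndGradientBudget` (`‖∂_{p_{N−1}}g_N‖², ‖r_N‖² ≤ T G_N/γ³`, `r_N := ∂_{p_{N−1}}g_N − (G_N/γ²)p_{N−1}`;
`κ‖g_0‖² + γTΣ_{b≠0}‖∂_{p_{s_b}}g_0‖² ≤ (T²/γ³)a(γ−a)`) and `helper_bypassGradientBudget`; the two `κ`-pairings vanish as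
`κ → 0` at fixed `N`. (S) `G_M∘R` and `V'(r_J)` do not depend on `p_{N−1}`, so the Rayleigh part of `∂_{p_{N−1}}g_N`
integrates to zero: `S|_{κ=0} = ⟨(G_M∘R)·V'(r_J), r_N∘π_N⟩ ≤ ‖V'(r_J)(G_M∘R)‖_{L²(μ_T)}·‖r_N∘π_N‖_{L²(μ_T)}` — second
factor `O(√G_N)` (up to the marginal constant of `helper_terminationMarginal`), first factor (UNDIFFERENTIATED far plain
field at the junction) NOT budgeted. (D) with `∂_{p_{M−1}}g_M = (G_M/γ²)p_{M−1} + r_M`: Rayleigh piece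
`(G_M/γ²)⟨g_0, V'(r_J)p_N⟩ = (T²G_M/γ³)(−K₀₂ − K₀₃) + κ`-term (junction power = energy balance of the right part, cf.
`helper_terminationJunctionPowerResolvent`), bounded by PSD only as `2T²G_M√(γa)/γ³` (row sum: `T²G_M(a + |K₀₁|)/γ³ + κ`-term,
sign of `K₀₁` open); fluctuation piece `−⟨u_0·V'(r_J), r_M∘π_M∘Φ∘R⟩ ≤ ‖V'(r_J)u_0‖_{L²(μ_T)}·‖r_M∘π_M∘Φ‖_{L²(μ_T)}` —
the UNDIFFERENTIATED near defect at the junction NOT budgeted (budgets: `κ‖u_0‖²`, `∂_{p_{N−1}}u_0`, `∂_{p_N}u_0 = ∂_{p_N}g_0`,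
all `O(√a + √G_N)`). Even with `O(1)` for the two unbudgeted norms the outcome is `O(√G_N + √G_M + G_M√a)`, not `O(ab)`:
each dissipation budget is one factor `√G` short of the Kirchhoff size. Standard axioms only.
-/

noncomputable section

open MeasureTheory Filter Topology
open scoped ContDiff
open Literature.MathematicalPhysics.KineticTheory.HeatConduction
open Summit.AtomisticToContinuum.FouriersLaw.Theorems.SuperadditiveResistance.DeviceLiouville
  (kin deviceGenerator deviceWeight deviceGenerator_eq kin_eq_sq liouvilleOp bathOp)
open Summit.AtomisticToContinuum.FouriersLaw.Theorems.SuperadditiveResistance.Kubo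
  (rev rev_apply contDiff_rev memLp_rev rev_pair partialP_rev cross integrable_mul_mul_gibbsDensity)
open Summit.AtomisticToContinuum.FouriersLaw.Theorems.SuperadditiveResistance.TerminationLocality
  (restrictLeft contDiff_restrictLeft contDiff_comp_restrictLeft memLp_comp_restrictLeft blockSwap blockSwap_fst
    blockSwap_snd blockSwap_blockSwap swapIdx swapIdx_val partialP_comp_blockSwap deviceGenerator_comp_blockSwap_const
    memLp_comp_blockSwap pinnedChain_V_even)
open Summit.AtomisticToContinuum.FouriersLaw.Cruxes.SuperadditiveResistance.ThermaliseThenCutProbeInsertion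
  (partialP_comp_restrictLeft_castAdd)

namespace Summit.AtomisticToContinuum.FouriersLaw.Cruxes.SuperadditiveResistance.FloatingProbeBypassLaplacian

/-! ## §1 The far block's plain field and junction source, read on the device -/

section FarBlock

variable {ω₂ lam β γ T : ℝ} {N M : ℕ}

/-- The junction force is ODD under the block swap: `V'(r_J)(Φ x) = −V'(r_J)(x)` (`r_J ↦ −r_J`). -/
theorem junctionForce_blockSwap (β : ℝ) (hN : 1 ≤ N) (hM : 1 ≤ M) (x : PhaseSpace (N + M)) :
    junctionForce β hM hN (blockSwap N M x) = -junctionForce β hN hM x := by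
  have i1 : swapIdx N M ⟨M, by omega⟩ = ⟨N - 1, by omega⟩ := Fin.ext (by simp only [swapIdx_val]; omega)
  have i2 : swapIdx N M ⟨M - 1, by omega⟩ = ⟨N, by omega⟩ := Fin.ext (by simp only [swapIdx_val]; omega)
  have h1 : (blockSwap N M x).1 ⟨M, by omega⟩ = x.1 ⟨N - 1, by omega⟩ := by rw [blockSwap_fst, i1]
  have h2 : (blockSwap N M x).1 ⟨M - 1, by omega⟩ = x.1 ⟨N, by omega⟩ := by rw [blockSwap_fst, i2]
  simp only [junctionForce, h1, h2]
  ring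

/-- **The far junction source in device coordinates**: with the FAR PLAIN LIFT `G_M = g_M∘π_M∘Φ` of a field `g_M` of
the bare `M`-chain, `J_M := (V'·(∂_{p_{M−1}} g_M)∘π_M)∘Φ = −V'(q_N − q_{N−1})·∂_{p_N} G_M` (the junction momentum of the
swapped device is `p_N`; no differentiability needed). -/
theorem farJunctionSource_eq (β : ℝ) (hN : 1 ≤ N) (hM : 1 ≤ M) (gM : PhaseSpace M → ℝ) (x : PhaseSpace (N + M)) :
    junctionForce β hM hN (blockSwap N M x) * partialP ⟨M - 1, by omega⟩ gM (restrictLeft M N (blockSwap N M x)) =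
      -(junctionForce β hN hM x *
        partialP ⟨N, by omega⟩ (fun y : PhaseSpace (N + M) => gM (restrictLeft M N (blockSwap N M y))) x) := by
  have e : (fun y : PhaseSpace (N + M) => gM (restrictLeft M N (blockSwap N M y))) =
      (gM ∘ fun y : PhaseSpace (M + N) => (y.1 ∘ Fin.castAdd N, y.2 ∘ Fin.castAdd N)) ∘ blockSwap N M := rfl
  have hj : swapIdx M N ⟨N, by omega⟩ = Fin.castAdd N ⟨M - 1, by omega⟩ := by
    apply Fin.ext
    simp only [swapIdx_val, Fin.val_castAdd]
    omega
  rw [e, partialP_comp_blockSwap, hj, partialP_comp_restrictLeft_castAdd, junctionForce_blockSwap]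
  simp only [restrictLeft]
  ring

/-- The far plain lift of a `C²` field is `C²`. -/
theorem contDiff_farPlainLift {gM : PhaseSpace M → ℝ} (h : ContDiff ℝ 2 gM) :
    ContDiff ℝ 2 (fun y : PhaseSpace (N + M) => gM (restrictLeft M N (blockSwap N M y))) := by
  have e : (fun y : PhaseSpace (N + M) => gM (restrictLeft M N (blockSwap N M y))) =
      (gM ∘ restrictLeft M N) ∘ blockSwap N M := rfl
  rw [e]
  exact (contDiff_comp_restrictLeft h).comp (blockSwap N M).contDiff

/-- The far plain lift of an `L²(μ_T^{(M)})` field is in `L²(μ_T^{(N+M)})` (marginal domination and block swap). -/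
theorem memLp_farPlainLift (hω : 0 < ω₂) (hl : 0 ≤ lam) (hβ : 0 ≤ β) (hN : 1 ≤ N) (hM : 1 ≤ M) (hT : 0 < T)
    {gM : PhaseSpace M → ℝ} (h : MemLp gM 2 ((pinnedChain ω₂ lam β γ).gibbsMeasure M T)) :
    MemLp (fun y : PhaseSpace (N + M) => gM (restrictLeft M N (blockSwap N M y))) 2
      ((pinnedChain ω₂ lam β γ).gibbsMeasure (N + M) T) := by
  have e : (fun y : PhaseSpace (N + M) => gM (restrictLeft M N (blockSwap N M y))) =
      (fun y : PhaseSpace (M + N) => gM (y.1 ∘ Fin.castAdd N, y.2 ∘ Fin.castAdd N)) ∘ blockSwap N M := rfl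
  rw [e]
  exact memLp_comp_blockSwap _ (pinnedChain_V_even ω₂ lam β γ) T (memLp_comp_restrictLeft hω hl hβ γ hM hN hT h)

/-- The far junction source of a plain forward field is in `L²(μ_T^{(N+M)})` (junction Boltzmann factor, block swap). -/
theorem memLp_farJunctionSource (hω : 0 < ω₂) (hl : 0 ≤ lam) (hβ : 0 ≤ β) (hγ : 0 < γ) (hN : 1 ≤ N) (hM : 1 ≤ M)
    (hT : 0 < T) {gM : PhaseSpace M → ℝ} (hgM : gM ∈ plainForwardFields ω₂ lam β γ T M) :
    MemLp (fun y : PhaseSpace (N + M) => junctionForce β hM hN (blockSwap N M y) *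
        partialP ⟨M - 1, by omega⟩ gM (restrictLeft M N (blockSwap N M y))) 2
      ((pinnedChain ω₂ lam β γ).gibbsMeasure (N + M) T) := by
  have e : (fun y : PhaseSpace (N + M) => junctionForce β hM hN (blockSwap N M y) *
      partialP ⟨M - 1, by omega⟩ gM (restrictLeft M N (blockSwap N M y))) =
      (fun y : PhaseSpace (M + N) => junctionForce β hM hN y *
        partialP ⟨M - 1, by omega⟩ gM (y.1 ∘ Fin.castAdd N, y.2 ∘ Fin.castAdd N)) ∘ blockSwap N M := rfl
  rw [e]
  exact memLp_comp_blockSwap _ (pinnedChain_V_even ω₂ lam β γ) T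
    (memLp_junctionSource hω hl hβ hγ hM hN hT hgM.1 hgM.2.1 hgM.2.2.2)

/-- The far junction source of a `C²` field is continuous. -/
theorem continuous_farJunctionSource (hN : 1 ≤ N) (hM : 1 ≤ M) {gM : PhaseSpace M → ℝ} (h : ContDiff ℝ 2 gM) :
    Continuous (fun y : PhaseSpace (N + M) => junctionForce β hM hN (blockSwap N M y) *
      partialP ⟨M - 1, by omega⟩ gM (restrictLeft M N (blockSwap N M y))) := by
  have hc : Continuous (partialP ⟨M - 1, by omega⟩ gM) :=
    continuous_partialP (h.of_le (by norm_cast) : ContDiff ℝ 1 gM) one_ne_zero _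
  have h1 : Continuous fun x : PhaseSpace (N + M) => restrictLeft M N (blockSwap N M x) :=
    (contDiff_restrictLeft (n := 1)).continuous.comp (blockSwap N M).continuous
  have h2 : Continuous fun x : PhaseSpace (N + M) => junctionForce β hM hN (blockSwap N M x) := by
    have h3 : Continuous fun y : PhaseSpace (M + N) => junctionForce β hM hN y := by
      unfold junctionForce
      fun_prop
    exact h3.comp (blockSwap N M).continuous
  exact h2.mul (hc.comp h1)

/-! ### The far defect and its resolvent equation -/

/-- **The far defect's resolvent equation (fixed `N`; exact).** For a `κ`-resolvent field `g_3` of the far bath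
(site `N+M−1`) of the `(N, M)`-device and a plain forward field `g_M` of the bare `M`-chain (`N, M ≥ 1`), the FAR
DEFECT `v_3 := g_3 − G_M` (`G_M = g_M∘π_M∘Φ`) solves `κ v_3 − L_dev v_3 = −κ G_M + J_M`: the near defect equation
`deviceResolvent_defect` of the swapped `(M, N)`-device (there `g_3∘Φ_{M,N}` is the near resolvent field,
`comp_blockSwap_mem_deviceResolventFields`) transported back along `Φ_{N,M}` (`deviceGenerator_comp_blockSwap_const`). -/
theorem farDefect_resolvent (κ : ℝ) (hN : 1 ≤ N) (hM : 1 ≤ M) {g₃ : PhaseSpace (N + M) → ℝ}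
    (hg₃ : g₃ ∈ deviceResolventFields ω₂ lam β γ T N M (N + M - 1) κ)
    {gM : PhaseSpace M → ℝ} (hgM : gM ∈ plainForwardFields ω₂ lam β γ T M) (x : PhaseSpace (N + M)) :
    κ * (g₃ x - gM (restrictLeft M N (blockSwap N M x))) -
        deviceGenerator (pinnedChain ω₂ lam β γ) N M (fun _ => T)
          (fun y => g₃ y - gM (restrictLeft M N (blockSwap N M y))) x =
      -(κ * gM (restrictLeft M N (blockSwap N M x))) +
        junctionForce β hM hN (blockSwap N M x) * partialP ⟨M - 1, by omega⟩ gM (restrictLeft M N (blockSwap N M x)) := by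
  -- the far field is the NEAR resolvent field of the swapped device
  have hg' : g₃ ∘ blockSwap M N ∈ deviceResolventFields ω₂ lam β γ T M N 0 κ :=
    comp_blockSwap_mem_deviceResolventFields hN hM (s := N + M - 1) (s' := 0) (by omega) (by omega) hg₃
  obtain ⟨hg'C, -, hpde'⟩ := hg'
  obtain ⟨hgMC, -, -, hgMpde⟩ := hgM
  have h := deviceResolvent_defect ω₂ lam β γ T κ hM hN hg'C hgMC hpde' hgMpde (blockSwap N M x)
  -- transport back along `Φ_{N,M}`
  have h2 := deviceGenerator_comp_blockSwap_const (pinnedChain ω₂ lam β γ) (pinnedChain_V_even ω₂ lam β γ) hN hM T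
    (fun y : PhaseSpace (M + N) => (g₃ ∘ blockSwap M N) y - gM (restrictLeft M N y)) x
  have e : (fun y : PhaseSpace (M + N) => (g₃ ∘ blockSwap M N) y - gM (restrictLeft M N y)) ∘ blockSwap N M =
      fun y => g₃ y - gM (restrictLeft M N (blockSwap N M y)) := by
    funext y
    simp only [Function.comp_apply, blockSwap_blockSwap]
  rw [e] at h2
  rw [← h2, Function.comp_apply, blockSwap_blockSwap] at h
  exact h

/-- The far defect equation in PAIR FORM: `X_H v_3 + γ S_B v_3 = −(J_M − κ g_3)`, `B = deviceWeight N M` (the form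
consumed by the landed Kubo toolkit). -/
theorem farDefect_pair_far (κ : ℝ) (hN : 1 ≤ N) (hM : 1 ≤ M) {g₃ : PhaseSpace (N + M) → ℝ}
    (hg₃ : g₃ ∈ deviceResolventFields ω₂ lam β γ T N M (N + M - 1) κ)
    {gM : PhaseSpace M → ℝ} (hgM : gM ∈ plainForwardFields ω₂ lam β γ T M) (x : PhaseSpace (N + M)) :
    1 * liouvilleOp (pinnedChain ω₂ lam β γ) (N + M) (fun y => g₃ y - gM (restrictLeft M N (blockSwap N M y))) x +
        γ * bathOp (N + M) (deviceWeight N M) T (fun y => g₃ y - gM (restrictLeft M N (blockSwap N M y))) x =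
      -(junctionForce β hM hN (blockSwap N M x) * partialP ⟨M - 1, by omega⟩ gM (restrictLeft M N (blockSwap N M x)) -
        κ * g₃ x) := by
  have h := farDefect_resolvent κ hN hM hg₃ hgM x
  rw [deviceGenerator_eq] at h
  have hγ' : (pinnedChain ω₂ lam β γ).γ = γ := rfl
  rw [hγ'] at h
  linarith

end FarBlock

/-! ## §2 Reciprocity of the two defects and the double-defect identity -/

section DoubleDefect

variable {ω₂ lam β γ T : ℝ} {N M : ℕ}

/-- **RECIPROCITY OF THE TWO DEFECTS (fixed `N, M, κ`; exact).** For `κ`-resolvent fields `g_0` (bath `0`) and `g_3`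
(far bath `N+M−1`) of the `(N, M)`-device and plain forward fields `g_N`, `g_M` of the two bare blocks (`N, M ≥ 1`):

  `⟨v_3∘R, s_N⟩_{μ_T} = ⟨u_0, s_M∘R⟩_{μ_T}`,

`u_0 = g_0 − g_N∘π_N`, `s_N = V'(r_J)(∂_{p_{N−1}}g_N)∘π_N − κ g_N∘π_N` (near defect and its source), `v_3 = g_3 − G_M`,
`s_M = J_M − κ G_M` (far defect and its source, `G_M = g_M∘π_M∘Φ`, `J_M` of `farJunctionSource_eq`): the landed cross
Green identity `Kubo.cross` for the forward pair `(u_0, s_N − κ u_0)` (`farDefect_pair`) against the backward pair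
`(v_3∘R, s_M∘R − κ v_3∘R)` (`farDefect_pair_far`, `rev_pair`); the two `κ⟨u_0, v_3∘R⟩` cancel. -/
theorem defect_reciprocity (hω : 0 < ω₂) (hl : 0 ≤ lam) (hβ : 0 ≤ β) (hγ : 0 < γ) (hN : 1 ≤ N) (hM : 1 ≤ M)
    (hT : 0 < T) (κ : ℝ) {g₀ g₃ : PhaseSpace (N + M) → ℝ}
    (hg₀ : g₀ ∈ deviceResolventFields ω₂ lam β γ T N M 0 κ)
    (hg₃ : g₃ ∈ deviceResolventFields ω₂ lam β γ T N M (N + M - 1) κ)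
    {gN : PhaseSpace N → ℝ} (hgN : gN ∈ plainForwardFields ω₂ lam β γ T N)
    {gM : PhaseSpace M → ℝ} (hgM : gM ∈ plainForwardFields ω₂ lam β γ T M) :
    ∫ x, (g₃ (x.1, -x.2) - gM (restrictLeft M N (blockSwap N M (x.1, -x.2)))) *
        (junctionForce β hN hM x * partialP ⟨N - 1, by omega⟩ gN (x.1 ∘ Fin.castAdd M, x.2 ∘ Fin.castAdd M) -
          κ * gN (x.1 ∘ Fin.castAdd M, x.2 ∘ Fin.castAdd M)) ∂((pinnedChain ω₂ lam β γ).gibbsMeasure (N + M) T) =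
      ∫ x, (g₀ x - gN (x.1 ∘ Fin.castAdd M, x.2 ∘ Fin.castAdd M)) *
        (junctionForce β hM hN (blockSwap N M (x.1, -x.2)) *
            partialP ⟨M - 1, by omega⟩ gM (restrictLeft M N (blockSwap N M (x.1, -x.2))) -
          κ * gM (restrictLeft M N (blockSwap N M (x.1, -x.2))))
        ∂((pinnedChain ω₂ lam β γ).gibbsMeasure (N + M) T) := by
  obtain ⟨hg₀C, hg₀L, hpde₀⟩ := hg₀
  have hg₃' := hg₃
  obtain ⟨hg₃C, hg₃L, -⟩ := hg₃
  obtain ⟨hgC, hgL2, -, hgpde⟩ := hgN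
  have hgM' := hgM
  obtain ⟨hgMC, hgML2, -, -⟩ := hgM
  set P := pinnedChain ω₂ lam β γ with hP
  set μ := P.gibbsMeasure (N + M) T with hμ
  -- the players
  set gNπ : PhaseSpace (N + M) → ℝ := fun x => gN (x.1 ∘ Fin.castAdd M, x.2 ∘ Fin.castAdd M) with hgNπ
  set u : PhaseSpace (N + M) → ℝ := fun y => g₀ y - gN (y.1 ∘ Fin.castAdd M, y.2 ∘ Fin.castAdd M) with hu
  set JN : PhaseSpace (N + M) → ℝ := fun x => junctionForce β hN hM x *
    partialP ⟨N - 1, by omega⟩ gN (x.1 ∘ Fin.castAdd M, x.2 ∘ Fin.castAdd M) with hJN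
  set G : PhaseSpace (N + M) → ℝ := fun y => gM (restrictLeft M N (blockSwap N M y)) with hG
  set JM : PhaseSpace (N + M) → ℝ := fun y => junctionForce β hM hN (blockSwap N M y) *
    partialP ⟨M - 1, by omega⟩ gM (restrictLeft M N (blockSwap N M y)) with hJM
  set v : PhaseSpace (N + M) → ℝ := fun y => g₃ y - gM (restrictLeft M N (blockSwap N M y)) with hv
  -- regularity
  have hgNπC : ContDiff ℝ 2 gNπ := contDiff_comp_restrictLeft hgC
  have hgNπL : MemLp gNπ 2 μ := memLp_comp_restrictLeft hω hl hβ γ hN hM hT hgL2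
  have huC : ContDiff ℝ 2 u := hg₀C.sub hgNπC
  have huL : MemLp u 2 μ := hg₀L.sub hgNπL
  have hGC : ContDiff ℝ 2 G := contDiff_farPlainLift hgMC
  have hGL : MemLp G 2 μ := memLp_farPlainLift hω hl hβ hN hM hT hgML2
  have hvC : ContDiff ℝ 2 v := hg₃C.sub hGC
  have hvL : MemLp v 2 μ := hg₃L.sub hGL
  have hrvC : ContDiff ℝ 2 (rev v) := contDiff_rev hvC
  have hrvL : MemLp (rev v) 2 μ := memLp_rev hω hl hβ (N + M) hT hvC.continuous hvL
  have hrGL : MemLp (rev G) 2 μ := memLp_rev hω hl hβ (N + M) hT hGC.continuous hGL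
  have hrg₃L : MemLp (rev g₃) 2 μ := memLp_rev hω hl hβ (N + M) hT hg₃C.continuous hg₃L
  have hJNL : MemLp JN 2 μ := memLp_junctionSource hω hl hβ hγ hN hM hT hgC hgL2 hgpde
  have hJML : MemLp JM 2 μ := memLp_farJunctionSource hω hl hβ hγ hN hM hT hgM'
  have hrJML : MemLp (rev JM) 2 μ := memLp_rev hω hl hβ (N + M) hT (continuous_farJunctionSource hN hM hgMC) hJML
  have hkfL : MemLp (fun x => JN x - κ * g₀ x) 2 μ := hJNL.sub (hg₀L.const_mul κ)
  have hkhL : MemLp (fun x => rev JM x - κ * rev g₃ x) 2 μ := hrJML.sub (hrg₃L.const_mul κ)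
  -- the two pairs
  have hpair_u : ∀ x, 1 * liouvilleOp P (N + M) u x + γ * bathOp (N + M) (deviceWeight N M) T u x =
      -(JN x - κ * g₀ x) := fun x => farDefect_pair ω₂ lam β γ T κ hN hM hg₀C hgC hpde₀ hgpde x
  have hpair_v : ∀ x, 1 * liouvilleOp P (N + M) v x + γ * bathOp (N + M) (deviceWeight N M) T v x =
      -(JM x - κ * g₃ x) := fun x => farDefect_pair_far κ hN hM hg₃' hgM' x
  have hpair_rv : ∀ x, -1 * liouvilleOp P (N + M) (rev v) x + γ * bathOp (N + M) (deviceWeight N M) T (rev v) x =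
      -(rev JM x - κ * rev g₃ x) := by
    intro x
    have h := rev_pair P (deviceWeight N M) T 1 γ (k := fun y => JM y - κ * g₃ y) hpair_v x
    rw [h]
    rfl
  -- the cross Green identity (density form)
  have hcross := cross hω hl hβ (N + M) hT (deviceWeight N M) (deviceWeight_nonneg' N M) 1 hγ
    huC hrvC huL hrvL hkfL hkhL hpair_u hpair_rv
  -- split off the two `κ⟨u_0, v_3∘R⟩`
  set ρ := P.gibbsDensity (N + M) T with hρ
  have hsNL : MemLp (fun x => JN x - κ * gNπ x) 2 μ := hJNL.sub (hgNπL.const_mul κ)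
  have hsML : MemLp (fun x => rev JM x - κ * rev G x) 2 μ := hrJML.sub (hrGL.const_mul κ)
  have hI1 := integrable_mul_mul_gibbsDensity hω hl hβ γ (N + M) hT hrvL hsNL
  have hI2 := integrable_mul_mul_gibbsDensity hω hl hβ γ (N + M) hT hrvL huL
  have hI3 := integrable_mul_mul_gibbsDensity hω hl hβ γ (N + M) hT huL hsML
  have eL : ∫ x, rev v x * (JN x - κ * g₀ x) * ρ x =
      (∫ x, rev v x * (JN x - κ * gNπ x) * ρ x) - κ * ∫ x, rev v x * u x * ρ x := by
    rw [← integral_const_mul, ← integral_sub hI1 (hI2.const_mul κ)]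
    exact integral_congr_ae (ae_of_all _ fun x => by simp only [hu, hgNπ]; ring)
  have eR : ∫ x, u x * (rev JM x - κ * rev g₃ x) * ρ x =
      (∫ x, u x * (rev JM x - κ * rev G x) * ρ x) - κ * ∫ x, rev v x * u x * ρ x := by
    rw [← integral_const_mul, ← integral_sub hI3 (hI2.const_mul κ)]
    exact integral_congr_ae (ae_of_all _ fun x => by simp only [hv, hG, rev_apply]; ring)
  rw [eL, eR] at hcross
  have key : ∫ x, rev v x * (JN x - κ * gNπ x) * ρ x = ∫ x, u x * (rev JM x - κ * rev G x) * ρ x := by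
    linarith
  -- back to the Gibbs measure
  rw [P.integral_gibbsMeasure, P.integral_gibbsMeasure]
  have e1 : ∫ x, (g₃ (x.1, -x.2) - gM (restrictLeft M N (blockSwap N M (x.1, -x.2)))) *
      (junctionForce β hN hM x * partialP ⟨N - 1, by omega⟩ gN (x.1 ∘ Fin.castAdd M, x.2 ∘ Fin.castAdd M) -
        κ * gN (x.1 ∘ Fin.castAdd M, x.2 ∘ Fin.castAdd M)) * ρ x =
      ∫ x, rev v x * (JN x - κ * gNπ x) * ρ x :=
    integral_congr_ae (ae_of_all _ fun x => by simp only [hv, hJN, hgNπ, rev_apply])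
  have e2 : ∫ x, (g₀ x - gN (x.1 ∘ Fin.castAdd M, x.2 ∘ Fin.castAdd M)) *
      (junctionForce β hM hN (blockSwap N M (x.1, -x.2)) *
          partialP ⟨M - 1, by omega⟩ gM (restrictLeft M N (blockSwap N M (x.1, -x.2))) -
        κ * gM (restrictLeft M N (blockSwap N M (x.1, -x.2)))) * ρ x =
      ∫ x, u x * (rev JM x - κ * rev G x) * ρ x :=
    integral_congr_ae (ae_of_all _ fun x => by simp only [hu, hJM, hG, rev_apply])
  rw [e1, e2, key]

/-- **THE DOUBLE-DEFECT IDENTITY FOR THE BYPASS (fixed `N, M, κ`; exact).** For the pinned chain (`ω₂ > 0`,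
`lam, β ≥ 0`, `γ, T > 0`, `N, M ≥ 1`), any family `g` whose bath-`0` and bath-`3` members are `κ`-resolvent fields of
the `(N, M)`-device and ANY plain forward fields `g_N`, `g_M` of the two bare blocks:

  `−K₀₃ = (γ²/T²)·( ⟨u_0, (J_M − κ G_M)∘R⟩_{μ_T} + ⟨G_M∘R, V'(r_J)(∂_{p_{N−1}}g_N)∘π_N − κ g_N∘π_N⟩_{μ_T} )`

(`u_0 = g_0 − g_N∘π_N` the near defect, `G_M = g_M∘π_M∘Φ` the far plain lift and `J_M` its junction source,
`farJunctionSource_eq`): part V's far-transmission identity `−K₀₃ = (γ²/T²)⟨g_3∘R, s_N⟩` with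
`g_3∘R = v_3∘R + G_M∘R` and `defect_reciprocity`. The first (DYNAMIC) term pairs the near DEFECT with the far block's
junction source, the second (STATIC) term is an equilibrium junction correlation of the two bare plain fields; no
undecomposed device field remains. -/
theorem bypass_eq_doubleDefect (hω : 0 < ω₂) (hl : 0 ≤ lam) (hβ : 0 ≤ β) (hγ : 0 < γ) (hT : 0 < T)
    (hN : 1 ≤ N) (hM : 1 ≤ M) (κ : ℝ) (g : Fin 4 → PhaseSpace (N + M) → ℝ)
    (hg₀ : g 0 ∈ deviceResolventFields ω₂ lam β γ T N M 0 κ)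
    (hg₃ : g 3 ∈ deviceResolventFields ω₂ lam β γ T N M (N + M - 1) κ)
    {gN : PhaseSpace N → ℝ} (hgN : gN ∈ plainForwardFields ω₂ lam β γ T N)
    {gM : PhaseSpace M → ℝ} (hgM : gM ∈ plainForwardFields ω₂ lam β γ T M) :
    -(kuboMatrix ω₂ lam β γ T N M g 0 3) = γ ^ 2 / T ^ 2 *
      ((∫ x, (g 0 x - gN (x.1 ∘ Fin.castAdd M, x.2 ∘ Fin.castAdd M)) *
          (junctionForce β hM hN (blockSwap N M (x.1, -x.2)) *
              partialP ⟨M - 1, by omega⟩ gM (restrictLeft M N (blockSwap N M (x.1, -x.2))) -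
            κ * gM (restrictLeft M N (blockSwap N M (x.1, -x.2))))
          ∂((pinnedChain ω₂ lam β γ).gibbsMeasure (N + M) T)) +
        ∫ x, gM (restrictLeft M N (blockSwap N M (x.1, -x.2))) *
          (junctionForce β hN hM x * partialP ⟨N - 1, by omega⟩ gN (x.1 ∘ Fin.castAdd M, x.2 ∘ Fin.castAdd M) -
            κ * gN (x.1 ∘ Fin.castAdd M, x.2 ∘ Fin.castAdd M)) ∂((pinnedChain ω₂ lam β γ).gibbsMeasure (N + M) T)) := by
  rw [bypass_eq_farPairing hω hl hβ hγ hT hN hM κ g gN hg₀ hg₃ hgN,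
    ← defect_reciprocity hω hl hβ hγ hN hM hT κ hg₀ hg₃ hgN hgM]
  congr 1
  obtain ⟨hg₃C, hg₃L, -⟩ := hg₃
  obtain ⟨hgC, hgL2, -, hgpde⟩ := hgN
  obtain ⟨hgMC, hgML2, -, -⟩ := hgM
  set μ := (pinnedChain ω₂ lam β γ).gibbsMeasure (N + M) T with hμ
  have hgNπL : MemLp (fun x : PhaseSpace (N + M) => gN (x.1 ∘ Fin.castAdd M, x.2 ∘ Fin.castAdd M)) 2 μ :=
    memLp_comp_restrictLeft hω hl hβ γ hN hM hT hgL2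
  have hJNL : MemLp (fun x : PhaseSpace (N + M) => junctionForce β hN hM x *
      partialP ⟨N - 1, by omega⟩ gN (x.1 ∘ Fin.castAdd M, x.2 ∘ Fin.castAdd M)) 2 μ :=
    memLp_junctionSource hω hl hβ hγ hN hM hT hgC hgL2 hgpde
  have hsNL : MemLp (fun x : PhaseSpace (N + M) => junctionForce β hN hM x *
      partialP ⟨N - 1, by omega⟩ gN (x.1 ∘ Fin.castAdd M, x.2 ∘ Fin.castAdd M) -
        κ * gN (x.1 ∘ Fin.castAdd M, x.2 ∘ Fin.castAdd M)) 2 μ := hJNL.sub (hgNπL.const_mul κ)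
  have hGC : ContDiff ℝ 2 (fun y : PhaseSpace (N + M) => gM (restrictLeft M N (blockSwap N M y))) :=
    contDiff_farPlainLift hgMC
  have hrGL : MemLp (rev (fun y : PhaseSpace (N + M) => gM (restrictLeft M N (blockSwap N M y)))) 2 μ :=
    memLp_rev hω hl hβ (N + M) hT hGC.continuous (memLp_farPlainLift hω hl hβ hN hM hT hgML2)
  have hrg₃L : MemLp (rev (g 3)) 2 μ := memLp_rev hω hl hβ (N + M) hT hg₃C.continuous hg₃L
  have hA : Integrable (fun x : PhaseSpace (N + M) => (g 3 (x.1, -x.2) - gM (restrictLeft M N (blockSwap N M (x.1, -x.2)))) *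
      (junctionForce β hN hM x * partialP ⟨N - 1, by omega⟩ gN (x.1 ∘ Fin.castAdd M, x.2 ∘ Fin.castAdd M) -
        κ * gN (x.1 ∘ Fin.castAdd M, x.2 ∘ Fin.castAdd M))) μ := (hrg₃L.sub hrGL).integrable_mul hsNL
  have hB : Integrable (fun x : PhaseSpace (N + M) => gM (restrictLeft M N (blockSwap N M (x.1, -x.2))) *
      (junctionForce β hN hM x * partialP ⟨N - 1, by omega⟩ gN (x.1 ∘ Fin.castAdd M, x.2 ∘ Fin.castAdd M) -
        κ * gN (x.1 ∘ Fin.castAdd M, x.2 ∘ Fin.castAdd M))) μ := hrGL.integrable_mul hsNL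
  have hC : Integrable (fun x : PhaseSpace (N + M) => g 3 (x.1, -x.2) *
      (((x.1 ⟨N, by omega⟩ - x.1 ⟨N - 1, by omega⟩) + β * (x.1 ⟨N, by omega⟩ - x.1 ⟨N - 1, by omega⟩) ^ 3) *
        partialP ⟨N - 1, by omega⟩ gN (x.1 ∘ Fin.castAdd M, x.2 ∘ Fin.castAdd M))) μ := hrg₃L.integrable_mul hJNL
  have hD : Integrable (fun x : PhaseSpace (N + M) => g 3 (x.1, -x.2) * gN (x.1 ∘ Fin.castAdd M, x.2 ∘ Fin.castAdd M)) μ :=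
    hrg₃L.integrable_mul hgNπL
  rw [← integral_add hA hB, ← integral_const_mul, ← integral_sub hC (hD.const_mul κ)]
  exact integral_congr_ae (ae_of_all _ fun x => by simp only [junctionForce]; ring)

/-- Registered helper sub-goal `helper_bypassDoubleDefectIdentity` of stub `stub_bypassBound` (= `bypass_eq_doubleDefect`
for the skeleton's resolvent FAMILIES, written out in skeleton vocabulary: the far plain lift REVERSED is
`G_M∘R = fun y => g_M (fun i => q_{L−1−i}, fun i => −p_{L−1−i})`, and `J_M∘R = V'(r_J)·∂_{p_N}(G_M∘R)` by
`farJunctionSource_eq` and `Kubo.partialP_rev`). -/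
theorem helper_bypassDoubleDefectIdentity : ∀ (ω₂ lam β γ T : ℝ), 0 < ω₂ → 0 ≤ lam → 0 ≤ β → 0 < γ → 0 < T → ∀ (N M : ℕ) (hN : 1 ≤ N) (hM : 1 ≤ M) (κ : ℝ) (g : Fin 4 → PhaseSpace (N + M) → ℝ) (gN : PhaseSpace N → ℝ) (gM : PhaseSpace M → ℝ), (∀ a : Fin 4, g a ∈ deviceResolventFields ω₂ lam β γ T N M (termSite N M a) κ) → gN ∈ plainForwardFields ω₂ lam β γ T N → gM ∈ plainForwardFields ω₂ lam β γ T M → -(kuboMatrix ω₂ lam β γ T N M g 0 3) = γ ^ 2 / T ^ 2 * ((∫ x, (g 0 x - gN (x.1 ∘ Fin.castAdd M, x.2 ∘ Fin.castAdd M)) * (((x.1 ⟨N, by omega⟩ - x.1 ⟨N - 1, by omega⟩) + β * (x.1 ⟨N, by omega⟩ - x.1 ⟨N - 1, by omega⟩) ^ 3) * partialP ⟨N, by omega⟩ (fun y : PhaseSpace (N + M) => gM (fun i : Fin M => y.1 ⟨N + M - 1 - i.val, by omega⟩, fun i : Fin M => -y.2 ⟨N + M - 1 - i.val, by omega⟩))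 x - κ * gM (fun i : Fin M => x.1 ⟨N + M - 1 - i.val, by omega⟩, fun i : Fin M => -x.2 ⟨N + M - 1 - i.val, by omega⟩)) ∂((pinnedChain ω₂ lam β γ).gibbsMeasure (N + M) T)) + ∫ x, gM (fun i : Fin M => x.1 ⟨N + M - 1 - i.val, by omega⟩, fun i : Fin M => -x.2 ⟨N + M - 1 - i.val, by omega⟩) * (((x.1 ⟨N, by omega⟩ - x.1 ⟨N - 1, by omega⟩) + β * (x.1 ⟨N, by omega⟩ - x.1 ⟨N - 1, by omega⟩) ^ 3) * partialP ⟨N - 1, by omega⟩ gN (x.1 ∘ Fin.castAdd M, x.2 ∘ Fin.castAdd M) - κ * gN (x.1 ∘ Fin.castAdd M, x.2 ∘ Fin.castAdd M)) ∂((pinnedChain ω₂ lam β γ).gibbsMeasure (N + M) T)) := by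
  intro ω₂ lam β γ T hω hl hβ hγ hT N M hN hM κ g gN gM hg hgN hgM
  rw [bypass_eq_doubleDefect hω hl hβ hγ hT hN hM κ g (hg 0) (hg 3) hgN hgM]
  have eR : rev (fun y : PhaseSpace (N + M) => gM (restrictLeft M N (blockSwap N M y))) =
      fun y : PhaseSpace (N + M) => gM (fun i : Fin M => y.1 ⟨N + M - 1 - i.val, by omega⟩,
        fun i : Fin M => -y.2 ⟨N + M - 1 - i.val, by omega⟩) := rfl
  have eG : ∀ x : PhaseSpace (N + M), gM (restrictLeft M N (blockSwap N M (x.1, -x.2))) =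
      gM (fun i : Fin M => x.1 ⟨N + M - 1 - i.val, by omega⟩, fun i : Fin M => -x.2 ⟨N + M - 1 - i.val, by omega⟩) :=
    fun x => rfl
  have eJ : ∀ x : PhaseSpace (N + M), junctionForce β hM hN (blockSwap N M (x.1, -x.2)) *
      partialP ⟨M - 1, by omega⟩ gM (restrictLeft M N (blockSwap N M (x.1, -x.2))) =
      junctionForce β hN hM x * partialP ⟨N, by omega⟩ (fun y : PhaseSpace (N + M) =>
        gM (fun i : Fin M => y.1 ⟨N + M - 1 - i.val, by omega⟩, fun i : Fin M => -y.2 ⟨N + M - 1 - i.val, by omega⟩)) x := by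
    intro x
    have hP : partialP ⟨N, by omega⟩ (fun y : PhaseSpace (N + M) => gM (restrictLeft M N (blockSwap N M y))) (x.1, -x.2) =
        -partialP ⟨N, by omega⟩ (rev (fun y : PhaseSpace (N + M) => gM (restrictLeft M N (blockSwap N M y)))) x := by
      rw [partialP_rev, neg_neg]
    have hF : junctionForce β hN hM (x.1, -x.2) = junctionForce β hN hM x := rfl
    rw [farJunctionSource_eq, hP, eR, hF]
    ring
  simp_rw [eJ, eG]
  rfl

end DoubleDefect

end Summit.AtomisticToContinuum.FouriersLaw.Cruxes.SuperadditiveResistance.FloatingProbeBypassLaplacian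

end
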